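import Mathlib
import HarnessLib
import Summits.NavierStokesRegularity.NavierStokesRegularity.Theorems.IsobarTomographyTubeAlternativeStubOseenAncientAnalytic
import Summits.NavierStokesRegularity.NavierStokesRegularity.Theorems.IsobarTomographyTubeAlternativeStubPeakZoomPatchLineLimit
import Summits.NavierStokesRegularity.NavierStokesRegularity.Theorems.SqueezeCycleSingularZoomExtraction
import Summits.NavierStokesRegularity.NavierStokesRegularity.Theorems.SqueezeCycleSingularZoomData
import Summits.NavierStokesRegularity.NavierStokesRegularity.Theorems.AdaptedFrequencyTangentFlowTransferAncientPressure

/-!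
# The vorticity-scale zoom at near-maximal vorticity peaks — crux stmt-NavierStokesRegularity-11739
# (`IsobarTomography.TubeAlternative`), line `analytic-propagation-local-patch`, stub `stub_peakZoomPatch`

Given the two-sided vorticity rate `c/(T − t) ≤ ‖ω(t)‖_∞ ≤ C/(T − t)` and `θ`-near-maximal
vorticity peaks `(t_k, x_k)`, `t_k → T`, of vanishing scale-free isobaric action, the zooms
`w_k(s, y) = c_k u(T + c_k²ν s, x_k + c_kν y)`, `c_k²ν = 1/|ω(t_k, x_k)|` (tree zoom kit:
`zoom_isClassical`, `zoom_oseen`, `zoom_norm_le`) are unit-viscosity Oseen-mild fields on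
`(−δ|ω(t_k,x_k)|, 0)` with a common Type-I bound and unit vorticity at the zoom time
`s₀(k) = −(T − t_k)|ω(t_k, x_k)| ∈ [−C, −θc]` of the peak. Bolzano–Weierstrass (`s₀ → σ`) and KNSS's
compactness (`exists_tendsto_of_typeI_seq_Ioo`, Acta Math. 203 (2009), Lemma 6.1, Prop. 4.1) give a
Type-I ancient mild limit `W` with one classical pressure on `(-∞, 0)`
(`exists_isClassicalNSSolutionOn_Iio_of_isTypeIAncientMild`) and `|curl W(σ, 0)| = 1` (uniform
time-Lipschitz bounds of the gradients). The action is scale-free (`zoom_action_eq`), so the defects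
`⟪curl w_k, ∇q_k⟫` vanish in `L¹` of the unit cylinders below `s₀(k)`; since
`∇q = Δw − (w·∇)w − ∂ₛw` converges only weakly along time lines (registered sub-goal
`stub_defectLineLimit`), the limit defect vanishes on `(σ − 1, σ) × B(0, 1)`
(`defect_eq_zero_of_action_tendsto_zero`: Fubini, dominated convergence, a sign argument on small
boxes). Finally `knssLimit_of_ancientPatch` shifts and sup-normalises `W` into the required
`IsKNSSBlowupLimit` (everything is scale covariant). References: Koch–Nadirashvili–Seregin–Šverák,
arXiv:0709.3599, Prop. 4.1, Lemma 6.1, proof of Thm. 6.2; Albritton–Barker, arXiv:1811.00502, §3.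
-/

-- the problem directory repeats the summit name (D-0017); core's `dupNamespace` linter fires
set_option linter.dupNamespace false

noncomputable section

namespace Summit.NavierStokesRegularity.NavierStokesRegularity.Theorems.TubeAlternative.AnalyticPropagation

open Set Filter Topology Function MeasureTheory Metric
open scoped RealInnerProductSpace NNReal ENNReal
open Literature.Analysis Literature.Analysis.FluidPDE
open Summit.NavierStokesRegularity.NavierStokesRegularity.Theorems

/-- Physical space `ℝ³` (file-local notation; the registered stub signature is stated with it). -/
local notation "E3" => EuclideanSpace ℝ (Fin 3)

/-- Iterated integration over a box `I × B ⊂ ℝ × ℝ³`, space variable outermost. [folklore] -/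
theorem setIntegral_box_eq {G : ℝ × E3 → ℝ} {I : Set ℝ} {B : Set E3}
    (hG : IntegrableOn G (I ×ˢ B) volume) :
    ∫ z in I ×ˢ B, G z = ∫ y in B, ∫ s in I, G (s, y) := by
  rw [Measure.volume_eq_prod] at hG ⊢
  unfold IntegrableOn at hG
  rw [← Measure.prod_restrict] at hG ⊢
  exact integral_prod_symm G hG

/-- **The limit defect vanishes on the limit cylinder.** In the setting of `stub_defectLineLimit`,
if the unit cylinders `Q_j = (s₀(j) − 1, s₀(j)) × B(0, 1)` lie in the windows, `s₀(j) → σ` with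
`(σ − 1, σ) ⊂ (a, b)`, and `∫_{Q_j} |⟪curl w_j, ∇q_j⟫| → 0`, then `⟪curl W, ∇q_W⟫ = 0` on
`(σ − 1, σ) × B(0, 1)` (box integrals converge by Fubini + dominated convergence, and are `→ 0`). -/
theorem defect_eq_zero_of_action_tendsto_zero
    {A : ℕ → ℝ} {w : ℕ → ℝ → E3 → E3} {q : ℕ → ℝ → E3 → ℝ} {W : ℝ → E3 → E3}
    {qW : ℝ → E3 → ℝ} {a b K₀ K₁ K₂ K₃ L σ : ℝ} {s₀ : ℕ → ℝ} (haσ : a < σ - 1) (hσb : σ < b)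
    (hb0 : b ≤ 0) (hL0 : 0 ≤ L)
    (hcl : ∀ᶠ j in atTop, A j ≤ a ∧ IsClassicalNSSolutionOn (Ioo (A j) 0) 1 0 (w j) (q j))
    (hB : ∀ᶠ j in atTop, ∀ s ∈ Ioo a b, ∀ y, ‖w j s y‖ ≤ K₀ ∧ ‖fderiv ℝ (w j s) y‖ ≤ K₁ ∧
      ‖iteratedFDeriv ℝ 2 (w j s) y‖ ≤ K₂ ∧ ‖iteratedFDeriv ℝ 3 (w j s) y‖ ≤ K₃)
    (hLip : ∀ᶠ j in atTop, ∀ s ∈ Ioo a b, ∀ t ∈ Ioo a b, ∀ y, ‖w j t y - w j s y‖ ≤ L * |t - s|)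
    (hW : IsClassicalNSSolutionOn (Iio 0) 1 0 W qW)
    (hpt : ∀ s < 0, ∀ y, Tendsto (fun j => w j s y) atTop (𝓝 (W s y)))
    (hptG : ∀ s < 0, ∀ y, Tendsto (fun j => fderiv ℝ (w j s) y) atTop (𝓝 (fderiv ℝ (W s) y)))
    (hs₀ : Tendsto s₀ atTop (𝓝 σ)) (hs₀w : ∀ᶠ j in atTop, A j < s₀ j - 1 ∧ s₀ j < 0)
    (hact : Tendsto (fun j => ∫ z in Ioo (s₀ j - 1) (s₀ j) ×ˢ ball (0 : E3) 1,
      |⟪curl (w j z.1) z.2, gradient (q j z.1) z.2⟫|) atTop (𝓝 0)) :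
    ∀ z ∈ Ioo (σ - 1) σ ×ˢ ball (0 : E3) 1, ⟪curl (W z.1) z.2, gradient (qW z.1) z.2⟫ = 0 := by
  set F : ℝ × E3 → ℝ := fun z => ⟪curl (W z.1) z.2, gradient (qW z.1) z.2⟫ with hF
  set Fj : ℕ → ℝ × E3 → ℝ := fun j z => ⟪curl (w j z.1) z.2, gradient (q j z.1) z.2⟫ with hFj
  have hσ0 : σ < 0 := hσb.trans_le hb0
  have hdefc : ∀ {S : Set ℝ} {u : ℝ → E3 → E3} {p : ℝ → E3 → ℝ}, IsOpen S →
      IsClassicalNSSolutionOn S 1 0 u p →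
      ContinuousOn (fun z : ℝ × E3 => ⟪curl (u z.1) z.2, gradient (p z.1) z.2⟫) (S ×ˢ univ) :=
    fun hS h => ((isSmoothSpaceTimeOn_curl h.smooth_velocity hS).inner
      (h.smooth_pressure.gradient hS.uniqueDiffOn)).continuousOn
  have hFc : ContinuousOn F (Iio 0 ×ˢ univ) := hdefc isOpen_Iio hW
  rintro ⟨s', y'⟩ ⟨hs', hy'⟩
  by_contra hne
  set ε : ℝ := |F (s', y')| / 2 with hε
  have hF0 : 0 < |F (s', y')| := abs_pos.2 hne
  have hε0 : 0 < ε := by positivity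
  have hcont : ContinuousAt F (s', y') :=
    hFc.continuousAt ((isOpen_Iio.prod isOpen_univ).mem_nhds ⟨hs'.2.trans hσ0, mem_univ _⟩)
  obtain ⟨η, hη, hηF⟩ := Metric.continuousAt_iff.1 hcont ε hε0
  have hy'1 : ‖y'‖ < 1 := mem_ball_zero_iff.1 hy'
  set m : ℝ := min (min (s' - (σ - 1)) (σ - s')) (1 - ‖y'‖) with hm
  have hm1 : m ≤ s' - (σ - 1) := (min_le_left _ _).trans (min_le_left _ _)
  have hm2 : m ≤ σ - s' := (min_le_left _ _).trans (min_le_right _ _)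
  have hm0 : 0 < m := lt_min (lt_min (by linarith [hs'.1]) (by linarith [hs'.2])) (by linarith)
  set ρ : ℝ := min (η / 2) (m / 3) with hρ
  have hρ0 : 0 < ρ := lt_min (by positivity) (by positivity)
  have hρη : ρ < η := (min_le_left _ _).trans_lt (by linarith)
  have hρm : 3 * ρ ≤ m := by linarith [min_le_right (η / 2) (m / 3)]
  have hI2 : s' - ρ ≤ s' + ρ := by linarith
  set I : Set ℝ := Icc (s' - ρ) (s' + ρ) with hI
  set Bx : Set (ℝ × E3) := I ×ˢ closedBall y' ρ with hBx
  have hIab : I ⊆ Ioo a b := fun s hs => ⟨by linarith [hs.1], by linarith [hs.2]⟩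
  have hI0 : ∀ s ∈ I, s < 0 := fun s hs => (hIab hs).2.trans_le hb0
  have hBxη : ∀ z ∈ Bx, dist z (s', y') < η := by
    rintro ⟨s, y⟩ ⟨hs, hy⟩
    rw [Prod.dist_eq]
    refine max_lt (hρη.trans_le' ?_) ((mem_closedBall.1 hy).trans_lt hρη)
    rw [Real.dist_eq]
    exact abs_le.2 ⟨by linarith [hs.1], by linarith [hs.2]⟩
  have hBxcpt : IsCompact Bx := isCompact_Icc.prod (isCompact_closedBall _ _)
  have hFint : IntegrableOn F Bx volume :=
    (hFc.mono fun z hz => ⟨hI0 z.1 hz.1, mem_univ _⟩).integrableOn_compact hBxcpt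
  have hclBx : ∀ᶠ j in atTop, IsClassicalNSSolutionOn (Ioo (A j) 0) 1 0 (w j) (q j) ∧
      Bx ⊆ Ioo (A j) 0 ×ˢ univ := by
    filter_upwards [hcl] with j hj
    exact ⟨hj.2, fun z hz => ⟨⟨hj.1.trans_lt (hIab hz.1).1, hI0 z.1 hz.1⟩, mem_univ _⟩⟩
  have hintj : ∀ᶠ j in atTop, IntegrableOn (Fj j) Bx volume := by
    filter_upwards [hclBx] with j hj
    exact ((hdefc isOpen_Ioo hj.1).mono hj.2).integrableOn_compact hBxcpt
  set Bd : ℝ := ‖curlCLM‖ * K₁ * (3 * K₂ + K₁ * K₀ + L) with hBd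
  have hbdj : ∀ᶠ j in atTop, ∀ s ∈ Ioo a b, ∀ y, ‖Fj j (s, y)‖ ≤ Bd := by
    filter_upwards [hcl, hB, hLip] with j hj hjB hjL
    intro s hs y
    have hsS : s ∈ Ioo (A j) 0 := ⟨hj.1.trans_lt hs.1, hs.2.trans_le hb0⟩
    obtain ⟨h0, h1, h2, -⟩ := hjB s hs y
    have hK₁ : 0 ≤ K₁ := (norm_nonneg _).trans h1
    calc ‖Fj j (s, y)‖ ≤ ‖curl (w j s) y‖ * ‖gradient (q j s) y‖ := norm_inner_le_norm _ _
      _ ≤ (‖curlCLM‖ * K₁) * (3 * K₂ + K₁ * K₀ + L) :=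
          mul_le_mul ((norm_curl_le _ _).trans (mul_le_mul_of_nonneg_left h1
            (ContinuousLinearMap.opNorm_nonneg _)))
            (norm_gradient_le_of_classical isOpen_Ioo hj.2 hsS h0 h1 h2
              (norm_deriv_timeLine_le isOpen_Ioo hj.2.smooth_velocity hL0 hjL hs hsS y))
            (norm_nonneg _) (mul_nonneg (ContinuousLinearMap.opNorm_nonneg _) hK₁)
      _ = Bd := by rw [hBd]
  have hlimBx : Tendsto (fun j => ∫ z in Bx, Fj j z) atTop (𝓝 (∫ z in Bx, F z)) := by
    rw [setIntegral_box_eq hFint]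
    refine Tendsto.congr' (hintj.mono fun j hj => (setIntegral_box_eq hj).symm) ?_
    haveI : IsFiniteMeasure (volume.restrict (closedBall y' ρ)) :=
      isFiniteMeasure_restrict.2 measure_closedBall_lt_top.ne
    refine tendsto_integral_filter_of_dominated_convergence (fun _ => Bd * volume.real I)
      ?_ ?_ (integrable_const _) (Eventually.of_forall fun y => ?_)
    · filter_upwards [hintj] with j hj
      have hj' : Integrable (Fj j) ((volume.restrict I).prod (volume.restrict (closedBall y' ρ))) := by
        rw [Measure.prod_restrict, ← Measure.volume_eq_prod]; exact hj
      exact hj'.integral_prod_right.aestronglyMeasurable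
    · filter_upwards [hbdj] with j hj
      exact Eventually.of_forall fun y => norm_setIntegral_le_of_norm_le_const
        measure_Icc_lt_top fun s hs => hj s (hIab hs) y
    · simp_rw [hI, integral_Icc_eq_integral_Ioc, ← intervalIntegral.integral_of_le hI2]
      exact stub_defectLineLimit _ _ _ _ _ _ _ _ _ _ _ _ _ _ hI2 (by linarith) (by linarith) hb0
        hL0 hcl hB hLip hW hpt hptG y
  have hsmall : ∀ᶠ j in atTop, ‖∫ z in Bx, Fj j z‖ ≤
      ∫ z in Ioo (s₀ j - 1) (s₀ j) ×ˢ ball (0 : E3) 1, |Fj j z| := by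
    have hnear : ∀ᶠ j in atTop, dist (s₀ j) σ < ρ := Metric.tendsto_nhds.1 hs₀ ρ hρ0
    filter_upwards [hclBx, hs₀w, hnear, hintj] with j hj hjw hjn hji
    rw [Real.dist_eq, abs_lt] at hjn
    have hsub : Bx ⊆ Ioo (s₀ j - 1) (s₀ j) ×ˢ ball (0 : E3) 1 := by
      rintro ⟨s, y⟩ ⟨hs, hy⟩
      refine ⟨⟨by linarith [hs.1], by linarith [hs.2]⟩, mem_ball_zero_iff.2 ?_⟩
      calc ‖y‖ ≤ ‖y'‖ + dist y y' := by
            rw [dist_eq_norm]; linarith [norm_le_insert' y y', norm_sub_rev y y']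
        _ ≤ ‖y'‖ + ρ := by linarith [mem_closedBall.1 hy]
        _ < 1 := by linarith [min_le_right (min (s' - (σ - 1)) (σ - s')) (1 - ‖y'‖)]
    have hcyl : IntegrableOn (fun z => |Fj j z|) (Ioo (s₀ j - 1) (s₀ j) ×ˢ ball (0 : E3) 1) volume := by
      refine IntegrableOn.mono_set ?_ (prod_mono Ioo_subset_Icc_self ball_subset_closedBall)
      refine ContinuousOn.integrableOn_compact (isCompact_Icc.prod (isCompact_closedBall _ _)) ?_
      refine ((hdefc isOpen_Ioo hj.1).mono ?_).norm
      exact fun z hz => ⟨⟨hjw.1.trans_le hz.1.1, hz.1.2.trans_lt hjw.2⟩, mem_univ _⟩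
    refine (norm_integral_le_integral_norm _).trans ?_
    exact setIntegral_mono_set hcyl (Eventually.of_forall fun z => abs_nonneg _)
      (Eventually.of_forall hsub)
  have hBx0 : ∫ z in Bx, F z = 0 :=
    tendsto_nhds_unique hlimBx (squeeze_zero_norm' hsmall hact)
  have hvol : volume Bx = ENNReal.ofReal (2 * ρ) * volume (closedBall y' ρ) := by
    rw [hBx, Measure.volume_eq_prod, Measure.prod_prod, hI, Real.volume_Icc,
      show s' + ρ - (s' - ρ) = 2 * ρ by ring]
  have hvoltop : volume Bx < ⊤ := by
    rw [hvol]; exact ENNReal.mul_lt_top ENNReal.ofReal_lt_top measure_closedBall_lt_top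
  have hvolpos : 0 < volume.real Bx := by
    refine ENNReal.toReal_pos (ne_of_gt ?_) hvoltop.ne
    rw [hvol]
    exact ENNReal.mul_pos (by positivity) (measure_closedBall_pos volume y' hρ0).ne'
  have hdev : ‖∫ z in Bx, (F z - F (s', y'))‖ ≤ ε * volume.real Bx :=
    norm_setIntegral_le_of_norm_le_const hvoltop fun z hz => (hηF (hBxη z hz)).le
  rw [integral_sub hFint (integrableOn_const hvoltop.ne), hBx0, setIntegral_const, zero_sub,
    norm_neg, norm_smul, Real.norm_eq_abs, Real.norm_eq_abs, abs_of_pos hvolpos, hε] at hdev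
  nlinarith

/-- **Stub `stub_peakZoomPatch` (line `analytic-propagation-local-patch` of crux
`IsobarTomography.TubeAlternative`).** The vorticity-scale zoom at `θ`-near-maximal vorticity peaks
of vanishing isobaric action yields a KNSS blow-up limit with classical pressure on `(-∞, 0)`,
Oseen-ancient, not slice-wise constant, whose isobaric defect vanishes on a non-empty open set
(module docstring for the proof). -/
theorem stub_peakZoomPatch :
    ∀ (ν T : ℝ), 0 < ν → 0 < T → ∀ (u : ℝ → E3 → E3) (p : ℝ → E3 → ℝ),
    IsMaximalSmoothSolution ν 0 u p T → IsLerayHopfOn T ν 0 (u 0) u →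
    HasRapidSpatialDecay (u 0) → IsTypeIBlowup u T →
    ∀ (c C t₁ : ℝ), 0 < c → t₁ ∈ Set.Ico 0 T →
    (∀ t ∈ Set.Ico t₁ T, (∃ x : E3, c / (T - t) ≤ ‖curl (u t) x‖) ∧
      ∀ x : E3, ‖curl (u t) x‖ ≤ C / (T - t)) →
    ∀ θ : ℝ, 0 < θ → θ < 1 → ∀ (tk : ℕ → ℝ) (xk : ℕ → E3), (∀ k, tk k ∈ Set.Ico t₁ T) →
    Tendsto tk atTop (𝓝 T) → (∀ k, 0 < ‖curl (u (tk k)) (xk k)‖) →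
    (∀ k, ∀ y : E3, θ * ‖curl (u (tk k)) y‖ ≤ ‖curl (u (tk k)) (xk k)‖) →
    Tendsto (fun k => ν⁻¹ ^ 2 *
      ∫ z in (Set.Ioo (tk k - 1 / ‖curl (u (tk k)) (xk k)‖) (tk k)) ×ˢ
        Metric.ball (xk k) (Real.sqrt (ν / ‖curl (u (tk k)) (xk k)‖)),
        |⟪curl (u z.1) z.2, gradient (p z.1) z.2⟫|) atTop (𝓝 0) →
    ∃ (v : ℝ → E3 → E3) (q : ℝ → E3 → ℝ), IsKNSSBlowupLimit v ∧
      IsClassicalNSSolutionOn (Set.Iio 0) 1 0 v q ∧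
      (∀ s t : ℝ, s < t → t < 0 → ∀ x : E3,
        v t x = Literature.Analysis.UnboundedOperators.heatExtension (v s) (t - s) x -
          oseenDuhamel 1 s v v t x) ∧
      ¬ (∀ t < 0, ∃ b : E3, v t = fun _ => b) ∧
      ∃ U : Set (ℝ × E3), IsOpen U ∧ U.Nonempty ∧ U ⊆ Set.Iio 0 ×ˢ Set.univ ∧
        ∀ z ∈ U, ⟪curl (v z.1) z.2, gradient (q z.1) z.2⟫ = 0 := by
  intro ν T hν hT u p hmax hLH hdec hI c C t₁ hc ht₁ hrate θ hθ _hθ1 tk xk htk htend hpos hnear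
    haction
  have hsol := hmax.1
  obtain ⟨C₀, δ, hδ, hδT, hrw⟩ : ∃ C₀ δ : ℝ, 0 < δ ∧ δ ≤ T ∧
      ∀ t ∈ Ioo (T - δ) T, ∀ x, Real.sqrt (T - t) * ‖u t x‖ ≤ C₀ := by
    obtain ⟨C', hC'⟩ := hI
    obtain ⟨T₁, hT₁T, hT₁⟩ := mem_nhdsLT_iff_exists_Ioo_subset.1 hC'
    refine ⟨C', min (T - T₁) T, lt_min (sub_pos.2 hT₁T) hT, min_le_right _ _, fun t ht x => ?_⟩
    have hpos : 0 < Real.sqrt (T - t) := Real.sqrt_pos.2 (sub_pos.2 ht.2)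
    have h1 : ‖u t x‖ ≤ C' / Real.sqrt (T - t) :=
      hT₁ ⟨by linarith [ht.1, min_le_left (T - T₁) T], ht.2⟩ x
    calc Real.sqrt (T - t) * ‖u t x‖ ≤ Real.sqrt (T - t) * (C' / Real.sqrt (T - t)) :=
          mul_le_mul_of_nonneg_left h1 hpos.le
      _ = C' := by field_simp
  set Ω : ℕ → ℝ := fun k => ‖curl (u (tk k)) (xk k)‖ with hΩ
  have hΩpos : ∀ k, 0 < Ω k := hpos
  have htkI : ∀ k, tk k ∈ Ico 0 T := fun k => ⟨ht₁.1.trans (htk k).1, (htk k).2⟩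
  have hTtk : ∀ k, 0 < T - tk k := fun k => sub_pos.2 (htk k).2
  have hup : ∀ k, (T - tk k) * Ω k ≤ C := fun k => by
    have h := (hrate (tk k) (htk k)).2 (xk k)
    rwa [le_div_iff₀ (hTtk k), mul_comm] at h
  have hθc : 0 < θ * c := mul_pos hθ hc
  have hlow : ∀ k, θ * c ≤ (T - tk k) * Ω k := fun k => by
    obtain ⟨x, hx⟩ := (hrate (tk k) (htk k)).1
    have h2 : θ * (c / (T - tk k)) ≤ Ω k := (mul_le_mul_of_nonneg_left hx hθ.le).trans (hnear k x)
    rw [mul_div_assoc', div_le_iff₀ (hTtk k)] at h2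
    linarith
  set cz : ℕ → ℝ := fun k => Real.sqrt (ν / Ω k) / ν with hcz
  have hczν : ∀ k, cz k * ν = Real.sqrt (ν / Ω k) := fun k => div_mul_cancel₀ _ hν.ne'
  have hcz2 : ∀ k, cz k ^ 2 * ν = 1 / Ω k := fun k => by
    simp only [hcz]
    rw [div_pow, Real.sq_sqrt (div_nonneg hν.le (hΩpos k).le)]
    field_simp
  have hczpos : ∀ k, 0 < cz k := fun k => div_pos (Real.sqrt_pos.2 (div_pos hν (hΩpos k))) hν
  have hα : (1 : ℝ) = ν / ν := (div_self hν.ne').symm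
  have hβ : ν = ν ^ 2 / ν := by field_simp
  set w : ℕ → ℝ → E3 → E3 := fun k =>
    (cz k * 1) • stPull (cz k ^ 2 * ν) (cz k * ν) T (xk k) u with hw
  set qz : ℕ → ℝ → E3 → ℝ := fun k =>
    (cz k * 1) ^ 2 • stPull (cz k ^ 2 * ν) (cz k * ν) T (xk k) p with hqz
  set A : ℕ → ℝ := fun k => -(δ / (cz k ^ 2 * ν)) with hAdef
  have hA : ∀ k, A k = -(δ * Ω k) := fun k => by
    simp only [hAdef, hcz2]; field_simp
  have hclw : ∀ k, IsClassicalNSSolutionOn (Ioo (A k) 0) 1 0 (w k) (qz k) := fun k =>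
    zoom_isClassical hν hsol hν hα hβ (hczpos k) hδT
  have hcw : ∀ k, ContinuousOn (uncurry (w k)) (Ioo (A k) 0 ×ˢ univ) := fun k =>
    zoom_continuousOn hν hsol hν hα hβ (hczpos k) hδT
  have hdivw : ∀ k, ∀ s ∈ Ioo (A k) 0, IsWeaklyDivFree (w k s) := fun k s hs =>
    zoom_isWeaklyDivFree hν hsol hν hα hβ (hczpos k) hδT hs
  have hmildw : ∀ k, ∀ s s' : ℝ, A k < s → s < s' → s' < 0 → ∀ y,
      w k s' y = UnboundedOperators.heatExtension (w k s) (s' - s) y -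
        oseenDuhamel 1 s (w k) (w k) s' y :=
    fun k s s' hs hss' hs' y => zoom_oseen hν hT hsol hLH hdec hν hα hβ (hczpos k) hδT hs hss' hs' y
  set C₁ : ℝ := 1 * C₀ / Real.sqrt ν with hC₁
  have hIw : ∀ k, ∀ s ∈ Ioo (A k) 0, ∀ y, ‖w k s y‖ ≤ C₁ / Real.sqrt (-s) :=
    fun k s hs y => zoom_norm_le hν hα hβ hν (hczpos k) hδT hrw hs y
  set s₀ : ℕ → ℝ := fun k => -((T - tk k) * Ω k) with hs₀
  have hs₀I : ∀ k, s₀ k ∈ Icc (-C) (-(θ * c)) := fun k => ⟨neg_le_neg (hup k), neg_le_neg (hlow k)⟩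
  have hTs₀ : ∀ k, T + cz k ^ 2 * ν * s₀ k = tk k := fun k => by
    rw [hcz2]; field_simp [(hΩpos k).ne']; ring
  have hs₀eq : ∀ k, (tk k - T) / (cz k ^ 2 * ν) = s₀ k := fun k => by
    rw [hcz2]; field_simp [(hΩpos k).ne']; ring
  have hω1 : ∀ k, ‖curl (w k (s₀ k)) 0‖ = 1 := fun k => by
    have hdu : Differentiable ℝ (u (T + cz k ^ 2 * ν * s₀ k)) := by
      rw [hTs₀]; exact (hsol.contDiff_velocity (htkI k)).differentiable (by simp)
    rw [curl_eq_curlCLM, show w k (s₀ k) =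
        fun z => (cz k * 1) • stPull (cz k ^ 2 * ν) (cz k * ν) T (xk k) u (s₀ k) z from rfl,
      fderiv_fun_const_smul (differentiable_stPull_slice hdu 0), fderiv_stPull, smul_smul, map_smul,
      ← curl_eq_curlCLM, smul_zero, add_zero, hTs₀, norm_smul,
      show cz k * 1 * (cz k * ν) = cz k ^ 2 * ν by ring, hcz2, Real.norm_eq_abs,
      abs_of_pos (by have := hΩpos k; positivity), one_div, inv_mul_cancel₀ (hΩpos k).ne']
  have hΩlim : Tendsto Ω atTop atTop := by
    have h1 : Tendsto (fun k => T - tk k) atTop (𝓝[>] 0) := by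
      refine tendsto_nhdsWithin_iff.2 ⟨?_, Eventually.of_forall fun k => hTtk k⟩
      simpa using (tendsto_const_nhds (x := T)).sub htend
    have h2 : Tendsto (fun k => θ * c * (T - tk k)⁻¹) atTop atTop :=
      (tendsto_inv_nhdsGT_zero.comp h1).const_mul_atTop hθc
    refine tendsto_atTop_mono (fun k => ?_) h2
    rw [← div_eq_mul_inv, div_le_iff₀ (hTtk k)]
    linarith [hlow k]
  have hAlim : Tendsto A atTop atBot := by
    rw [show A = fun k => -(δ * Ω k) from funext hA]
    exact tendsto_neg_atTop_atBot.comp (hΩlim.const_mul_atTop hδ)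
  obtain ⟨σ, hσmem, ψ, hψ, hψlim⟩ :=
    tendsto_subseq_of_bounded (isCompact_Icc.isBounded) (x := s₀) hs₀I
  rw [closure_Icc] at hσmem
  have hσ0 : σ < 0 := by linarith [hσmem.2]
  obtain ⟨φ, hφ, W, hWclass, hpt, hptG, -, -⟩ := exists_tendsto_of_typeI_seq_Ioo C₁
    (w := fun k => w (ψ k)) (hAlim.comp hψ.tendsto_atTop) (fun k => hcw (ψ k))
    (fun k => hdivw (ψ k)) (fun k => hmildw (ψ k)) (fun k => hIw (ψ k))
  set κ : ℕ → ℕ := fun j => ψ (φ j) with hκ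
  have hκt : Tendsto κ atTop atTop := hψ.tendsto_atTop.comp hφ.tendsto_atTop
  have hAκ : Tendsto (fun j => A (κ j)) atTop atBot := hAlim.comp hκt
  have hs₀κ : Tendsto (fun j => s₀ (κ j)) atTop (𝓝 σ) := hψlim.comp hφ.tendsto_atTop
  obtain ⟨qW, hWcl⟩ := exists_isClassicalNSSolutionOn_Iio_of_isTypeIAncientMild hWclass
  set a' : ℝ := -C - 2 with ha'
  set b' : ℝ := -(θ * c) / 2 with hb'
  have hab : a' - 1 < b' := by linarith [hσmem.1, hσmem.2]
  have hb'0 : b' < 0 := by linarith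
  obtain ⟨K₀, hK₀⟩ := exists_norm_iteratedFDeriv_le_of_typeI_Ioo C₁ 0 hab hb'0 one_pos
  obtain ⟨K₁, hK₁⟩ := exists_norm_iteratedFDeriv_le_of_typeI_Ioo C₁ 1 hab hb'0 one_pos
  obtain ⟨K₂, hK₂⟩ := exists_norm_iteratedFDeriv_le_of_typeI_Ioo C₁ 2 hab hb'0 one_pos
  obtain ⟨K₃, hK₃⟩ := exists_norm_iteratedFDeriv_le_of_typeI_Ioo C₁ 3 hab hb'0 one_pos
  obtain ⟨L, hL0, hL⟩ := exists_lipschitz_time_of_typeI_Ioo C₁ 0 hab hb'0 one_pos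
  obtain ⟨L₁, -, hL₁⟩ := exists_lipschitz_time_of_typeI_Ioo C₁ 1 hab hb'0 one_pos
  have hwin : ∀ {s}, s ∈ Ioo a' b' → s ∈ Ico (a' - 1 + 1) b' := fun hs => ⟨by linarith [hs.1], hs.2⟩
  have hev : ∀ᶠ j in atTop, A (κ j) < a' - 1 := hAκ.eventually (eventually_lt_atBot _)
  have hclj : ∀ᶠ j in atTop, A (κ j) ≤ a' ∧
      IsClassicalNSSolutionOn (Ioo (A (κ j)) 0) 1 0 (w (κ j)) (qz (κ j)) :=
    hev.mono fun j hj => ⟨by linarith, hclw _⟩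
  have hBj : ∀ᶠ j in atTop, ∀ s ∈ Ioo a' b', ∀ y, ‖w (κ j) s y‖ ≤ K₀ ∧
      ‖fderiv ℝ (w (κ j) s) y‖ ≤ K₁ ∧ ‖iteratedFDeriv ℝ 2 (w (κ j) s) y‖ ≤ K₂ ∧
      ‖iteratedFDeriv ℝ 3 (w (κ j) s) y‖ ≤ K₃ := by
    filter_upwards [hev] with j hj
    intro s hs y
    refine ⟨?_, ?_, hK₂ hj (hcw _) (hdivw _) (hmildw _) (hIw _) s (hwin hs) y,
      hK₃ hj (hcw _) (hdivw _) (hmildw _) (hIw _) s (hwin hs) y⟩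
    · simpa [norm_iteratedFDeriv_zero] using hK₀ hj (hcw _) (hdivw _) (hmildw _) (hIw _) s (hwin hs) y
    · simpa [norm_iteratedFDeriv_one] using hK₁ hj (hcw _) (hdivw _) (hmildw _) (hIw _) s (hwin hs) y
  have hLj : ∀ᶠ j in atTop, ∀ s ∈ Ioo a' b', ∀ t ∈ Ioo a' b', ∀ y,
      ‖w (κ j) t y - w (κ j) s y‖ ≤ L * |t - s| := by
    filter_upwards [hev] with j hj
    intro s hs t ht y
    have h := hL hj (hcw _) (hdivw _) (hmildw _) (hIw _) s (hwin hs) t (hwin ht) y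
    rwa [FluidPDE.norm_iteratedFDeriv_zero_sub] at h
  have hσwin : σ ∈ Ioo a' b' := ⟨by linarith [hσmem.1], by linarith [hσmem.2]⟩
  have hs₀win : ∀ k, s₀ k ∈ Ioo a' b' := fun k => ⟨by linarith [(hs₀I k).1], by linarith [(hs₀I k).2]⟩
  have hgrad : Tendsto (fun j => fderiv ℝ (w (κ j) (s₀ (κ j))) 0) atTop (𝓝 (fderiv ℝ (W σ) 0)) := by
    have h1 : Tendsto (fun j => fderiv ℝ (w (κ j) σ) 0) atTop (𝓝 (fderiv ℝ (W σ) 0)) :=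
      hptG σ hσ0 0
    have h2 : Tendsto (fun j => fderiv ℝ (w (κ j) (s₀ (κ j))) 0 - fderiv ℝ (w (κ j) σ) 0) atTop
        (𝓝 0) := by
      refine squeeze_zero_norm' (hev.mono fun j hj => ?_)
        (by simpa using ((hs₀κ.sub_const σ).abs.const_mul L₁))
      have h := hL₁ hj (hcw _) (hdivw _) (hmildw _) (hIw _) σ (hwin hσwin) (s₀ (κ j))
        (hwin (hs₀win _)) 0
      rwa [norm_iteratedFDeriv_one_sub] at h
    simpa using h2.add h1
  have hWω : ‖curl (W σ) 0‖ = 1 := by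
    have h := ((curlCLM.continuous.tendsto _).comp hgrad).norm
    refine tendsto_nhds_unique (h.congr fun j => ?_) tendsto_const_nhds
    show ‖curlCLM (fderiv ℝ (w (κ j) (s₀ (κ j))) 0)‖ = 1
    rw [← curl_eq_curlCLM]; exact hω1 _
  have hact : Tendsto (fun j => ∫ z in Ioo (s₀ (κ j) - 1) (s₀ (κ j)) ×ˢ ball (0 : E3) 1,
      |⟪curl (w (κ j) z.1) z.2, gradient (qz (κ j) z.1) z.2⟫|) atTop (𝓝 0) := by
    have hev2 : ∀ᶠ j in atTop, 0 ≤ tk (κ j) - cz (κ j) ^ 2 * ν := by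
      have h1 : Tendsto (fun j => tk (κ j) - cz (κ j) ^ 2 * ν) atTop (𝓝 (T - 0)) := by
        refine ((htend.comp hκt).sub ?_)
        simp_rw [hcz2]
        exact tendsto_const_nhds.div_atTop (hΩlim.comp hκt)
      rw [sub_zero] at h1
      exact (h1.eventually (lt_mem_nhds hT)).mono fun j hj => hj.le
    refine (haction.comp hκt).congr' ?_
    filter_upwards [hev2] with j hj
    have e1 : 1 / ‖curl (u (tk (κ j))) (xk (κ j))‖ = cz (κ j) ^ 2 * ν := (hcz2 _).symm
    have e2 : Real.sqrt (ν / ‖curl (u (tk (κ j))) (xk (κ j))‖) = cz (κ j) * ν := (hczν _).symm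
    rw [Function.comp_apply, e1, e2, ← hs₀eq]
    exact (zoom_action_eq hν (hczpos _) hsol (xk _) (htk _).2.le hj).symm
  have hpatch := defect_eq_zero_of_action_tendsto_zero (a := a') (b := b') (σ := σ)
    (s₀ := fun j => s₀ (κ j)) (A := fun j => A (κ j)) (w := fun j => w (κ j))
    (q := fun j => qz (κ j)) (K₀ := K₀) (K₁ := K₁) (K₂ := K₂) (K₃ := K₃)
    (by linarith [hσmem.1]) hσwin.2 hb'0.le hL0 hclj hBj hLj hWcl hpt hptG hs₀κ
    (hev.mono fun j hj => ⟨by linarith [(hs₀I (κ j)).1], by linarith [(hs₀I (κ j)).2]⟩) hact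
  have hcurlne : ∃ x : E3, curl (W σ) x ≠ 0 :=
    ⟨0, fun h => by rw [h, norm_zero] at hWω; exact zero_ne_one hWω⟩
  obtain ⟨v, q', hv, hvcl, hvos, hvnc, U, hUo, hUne, hUsub, hU0⟩ :=
    knssLimit_of_ancientPatch C₁ W qW hWclass hWcl σ hσ0 hcurlne
      (Ioo (σ - 1) σ ×ˢ ball (0 : E3) 1) (isOpen_Ioo.prod isOpen_ball)
      ⟨(σ - 1 / 2, 0), ⟨by norm_num, by norm_num⟩, mem_ball_self one_pos⟩
      (prod_mono (fun s hs => hs.2.le) (subset_univ _)) hpatch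
  exact ⟨v, q', hv, hvcl, hvos, hvnc, U, hUo, hUne, hUsub, hU0⟩


end Summit.NavierStokesRegularity.NavierStokesRegularity.Theorems.TubeAlternative.AnalyticPropagation

end
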